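import Summits.ResolutionOfSingularities.ResolutionOfSingularities.Theses.WildCones
import HarnessLib

/-!
# Crux `ConeExit` (stmt-ResolutionOfSingularities-16883) — birth skeleton (BC3), line `birth`

Route `ResolutionOfSingularities/WildCones`, crux #3 (rank 3): the ONE-STEP CONE EXIT LEMMA.
`ConeExit` = "p odd prime, n ≥ 3, κ perfect of characteristic p; if a state c (the coefficient
function of a(u₁ … uₙ) in the height-one atom zᵖ = a(u)) is isolated of multiplicity p and a
successor `step i τ c` (blow up the closed point, chart uᵢ, divide by uᵢᵖ, translate by τ, delete
p-th-power monomials) is AGAIN isolated of multiplicity p, then c has cleaned order EXACTLY p and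
its cone-invariance space L(a_p) is a LINE (dL c = 1)".

## The typed dynamics, factored (definitions `clean … dL` below)

The crux (like every engine item of the route) is stated over ONE `let`-bound coefficient calculus
(FrobeniusClosing's, verbatim). This file factors that calculus into honest definitions
`clean p c`, `bl i c`, `ord c`, `dv i s c`, `tr i τ s c`, `step p i τ c`, `ser p c`, `pd i f`,
`jac p c`, `Isol p c`, `MultP p c`, `OrdP p c`, `cone p c`, `Linv p c`, `dL p c` whose bodies are
the `let` bodies TOKEN FOR TOKEN (earlier lets replaced by the corresponding constant), so that the
crux unfolds to them by ζ/δ-reduction alone: `ConeExit_of` below is type-checked against the route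
decl `WildCones.ConeExit` BY NAME with no rewriting lemma. Provers of the stubs get named objects
with room for an API (`clean_apply`, `step` unfolding, `cone` as the degree-p part, …).

## The cut (three named stubs; `ConeExit_of` proved)

The grounder's and both route-review refuters' read-backs of this crux (item notes 2026-08-16:
"(A) Case A char-free; (B) near point ∈ P(Linv); (D) the containment through every near point —
the real content") agree on the seam, and the cut follows it; it is also the planner's foreseen
two-layer split "ConeExit ⇐ CaseAExit → ConeForcing [dL ≥ 1 rides inside]" (route header,
TWO-LAYER PLAN) with the riding lemma made explicit as the middle stub:

* `stub_caseA` — **CASE A EXIT (true in all characteristics; Lean size M).** If c has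
  multiplicity p (all cleaned monomials of degree ≥ p) and some successor `step i τ c` is isolated
  of multiplicity p, then c has cleaned order EXACTLY p. Contrapositive content: cleaned order
  m > p ⇒ in the uᵢ-chart the strict transform is z'ᵖ + uᵢ^{m−p}·a'(u'), and a multiplicity-p point
  y of the exceptional hyperplane E = {uᵢ = 0} ≅ 𝔸ⁿ⁻¹ needs ord_y a_m(v + ·) ≥ p − 1 ≥ 2 when
  m = p + 1 (so y lies on the hypersurface {a_m = 0} ∩ E ⊆ Sing, of local dimension n − 2 ≥ 1),
  while for m ≥ p + 2 all of E is singular: either way the Jacobian ideal of the successor has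
  positive-dimensional zero locus, so `κ[[u]] ⧸ jac` is not finite over κ — ¬ Isol. (Grounder:
  "ELEMENTARY and checks out … folklore blow-up chart computation; cf. CJS 2020 Lemma 6.33(1)".)
  Needs n ≥ 3 (for n = 2 the locus {a_m(1,t) = 0} is finite).
* `stub_nearDirection` — **NEAR POINTS LIE IN P(L) (true; Lean size M).** If c has cleaned order
  exactly p and the successor `step i τ c` again has multiplicity p, then the DIRECTION of the new
  closed point, v = e_i + Σ_{j ≠ i} τ_j e_j = `Function.update τ i 1`, lies in the cone-invariance
  space `Linv p c` = {w | a_p(X + wS) = a_p(X) + a_p(w)·Sᵖ}. Content: the uᵢ-free monomials of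
  degree 1 … p−1 of the successor are exactly the Hasse–Taylor coefficients of a_p(v + u'') in
  u'' ∈ H = {u''ᵢ = 0} (read off `tr ∘ dv ∘ bl`), and `clean` does not touch them; MultP of the
  successor kills them, so a_p(v + w) = a_p(v) + a_p(w) on H as a polynomial identity; homogeneity
  (a_p(λv + w) = λᵖ a_p(v) + a_p(w)) and (Xᵢ + S)ᵖ = Xᵢᵖ + Sᵖ in characteristic p turn this into
  the defining identity of `Linv` at v. This is Hironaka's "infinitely near points of the same
  multiplicity lie on P(Dir)" (Hironaka 1970 Thm 2; CJS 2020 Thm 3.14) at the κ-RATIONAL points the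
  dynamics visits, in this calculus; the same lemma serves NarrowRunsDie (d = 1 ⇒ the near point
  is unique). Field-theoretic hypotheses (perfect, p odd) are carried only to match the crux.
* `stub_coneForcing` — **CONE FORCING (the load-bearing stub; NEW, size L).** If c has cleaned
  order exactly p and a successor is ISOLATED of multiplicity p, then dL c ≤ 1. Contrapositive
  content (card wild-cones-cannot-hide, P3 + Chern forcing): d = dim L ≥ 2 ⇒ the
  gradient-invariance space M has m ≥ d + 1 ≥ 3; the Chern lemma `WildCones.ChernCriticalDirection`
  (support item stmt-16885, provable now: c_{s−1}(Ω¹_{ℙ^{s−1}}(p)) = ((p−1)ˢ + (−1)^{s−1})/p ≠ 0 for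
  p odd; Euler + Koszul) gives a critical direction q of the cone modulo M; G|_N is a p-th power on
  N = M ⊕ ⟨q⟩, and Sing(X') ∩ E ⊇ P(N) ∩ {Θ_N = 0} ∩ {a_{p+1} = 0} has a component of dimension
  ≥ m − 2 ≥ 1 through EVERY near point, so the successor is not isolated. False at p = 2 (contact
  form: a = u₁u₂ + u₃²u₄ + u₄⁵ + u₃⁷, n = 4), hence `p ≠ 2`; empty for n = 3 (a cleaned non-zero
  degree-p form in 3 variables has dL ≤ 1). Evidence: planner census p = 3, n = 4 (8/8 forced
  d = 2 successors non-isolated, 0/2483 violations), dual-lens census 68/68 (item evidence).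
* The assembly `ConeExit_of : Sig.stub_caseA → Sig.stub_nearDirection → Sig.stub_coneForcing →
  ConeExit` is PROVED (no `sorry` in its own term): unfold the crux to the factored calculus
  (definitional), get `OrdP` from Case A, `v ∈ Linv` with `v i = 1 ≠ 0` gives `1 ≤ dL`
  (`one_le_dL_of_mem`, proved here: a non-zero vector of a set spans a line inside its span), cone
  forcing gives `dL ≤ 1`. `ConeExit_proof : ConeExit` is the same with the `stub_*` plugged in.

Hypothesis `Isol c` of the crux (isolatedness of the START state) is used by no stub — the
route-review refuter's mutation finding (item note 2026-08-16: only MultP c, Isol (step i τ c),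
MultP (step i τ c) are used); the stubs are stated without it and the assembly discards it.

Disproof used: none on file for this crux (`ledger crux ls stmt-ResolutionOfSingularities-16883`:
no workfiles before this line — no `Disproof.lean`, no Negative lemmas; `ledger negatives
--problem ResolutionOfSingularities` (2026-08-17): 1 entry, `DefectlessFrames` stmt-19085 on valuation
frames — unrelated to tangent cones / near points). The p = 2
counterexample recorded on the item (contact-form exception) is honoured by `p ≠ 2` in
`stub_coneForcing`, the only stub that needs it.
-/

noncomputable section

-- single-problem summit: the doubled namespace component `ResolutionOfSingularities` is forced
set_option linter.dupNamespace false
set_option linter.unusedVariables false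

open Summit.ResolutionOfSingularities.ResolutionOfSingularities.Theses.WildCones (ConeExit)

namespace Summit.ResolutionOfSingularities.ResolutionOfSingularities.Cruxes.ConeExit.Lines.Birth

/-! ## The point-blow-up coefficient calculus of a height-one atom `zᵖ = a(u₁ … uₙ)` (the route's
`let` chain, factored token for token; a state is its coefficient function `c : (Fin n → ℕ) → κ`) -/

section Calculus

variable {n : ℕ} {κ : Type} [Field κ] (p : ℕ)

/-- CLEANING: delete the p-th-power monomials (all exponents divisible by `p`) — over a perfect
field they are p-th powers and are absorbed into `z`. [cite: HauserPerlega2019, §1] -/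
def clean (c : (Fin n → ℕ) → κ) : (Fin n → ℕ) → κ :=
  fun A => @ite κ (∀ j, p ∣ A j) (Classical.dec _) 0 (c A)

/-- BLOW-UP of the origin, chart `uᵢ` (`u_j = uᵢ u'_j` for `j ≠ i`): the monomial `u^A` becomes
`uᵢ^{|A|} ∏_{j≠i} u'_j^{A_j}`. [cite: Kollar2007, Ch. 3] -/
def bl (i : Fin n) (c : (Fin n → ℕ) → κ) : (Fin n → ℕ) → κ :=
  fun B => @ite κ (Finset.sum (Finset.univ.erase i) (fun j => B j) ≤ B i) (Classical.dec _) (c (Function.update B i (B i - Finset.sum (Finset.univ.erase i) (fun j => B j)))) 0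

/-- ORDER of a coefficient function (least total degree of a non-zero monomial; `sInf ∅ = 0`).
[folklore] -/
def ord (c : (Fin n → ℕ) → κ) : ℕ :=
  sInf {m : ℕ | ∃ A, c A ≠ 0 ∧ m = Finset.sum Finset.univ (fun j => A j)}

/-- DIVISION by `uᵢ^s`. [folklore] -/
def dv (i : Fin n) (s : ℕ) (c : (Fin n → ℕ) → κ) : (Fin n → ℕ) → κ :=
  fun B => c (Function.update B i (B i + s))

/-- TRANSLATION `u_j ↦ u_j + τ_j` for `j ≠ i` (Hasse–Taylor expansion with binomial
coefficients; the `D`-range `≤ B i + s` is large enough after a blow-up divided by `uᵢ^s`).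
[folklore] -/
def tr (i : Fin n) (τ : Fin n → κ) (s : ℕ) (c : (Fin n → ℕ) → κ) : (Fin n → ℕ) → κ :=
  fun B => Finset.sum (Fintype.piFinset (fun _ : Fin n => Finset.range (B i + s + 1))) (fun D => @ite κ (D i = 0) (Classical.dec _) (c (B + D) * Finset.prod (Finset.univ.erase i) (fun j => ((Nat.choose (B j + D j) (B j) : ℕ) : κ) * τ j ^ (D j))) 0)

/-- ONE STEP of the point-blow-up dynamics: clean, blow up in chart `i`, divide by `uᵢᵖ` (when the
cleaned order is `≥ p`), translate to the new closed point `τ`, clean again.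
[cite: HauserPerlega2019, §1] -/
def step (i : Fin n) (τ : Fin n → κ) (c : (Fin n → ℕ) → κ) : (Fin n → ℕ) → κ :=
  clean p (tr i τ (@ite ℕ (p ≤ ord (clean p c)) (Classical.dec _) p 0) (dv i (@ite ℕ (p ≤ ord (clean p c)) (Classical.dec _) p 0) (bl i (clean p c))))

/-- The cleaned state as a formal power series `a(u) ∈ κ[[u₁ … uₙ]]`. [folklore] -/
def ser (c : (Fin n → ℕ) → κ) : MvPowerSeries (Fin n) κ :=
  show MvPowerSeries (Fin n) κ from fun A : Fin n →₀ ℕ => clean p c ⇑A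

/-- Formal partial derivative `∂/∂uᵢ` on `κ[[u]]`. [folklore] -/
def pd (i : Fin n) (f : MvPowerSeries (Fin n) κ) : MvPowerSeries (Fin n) κ :=
  show MvPowerSeries (Fin n) κ from fun A : Fin n →₀ ℕ => ((A i + 1 : ℕ) : κ) * f (A + Finsupp.single i 1)

/-- The Jacobian ideal `(∂₁a, …, ∂ₙa) ⊆ κ[[u]]` of the cleaned state (the singular locus of
`zᵖ = a(u)` in characteristic `p` is `{∂a = 0}`). [cite: BoubakriGreuelMarkwig2010, §2] -/
def jac (c : (Fin n → ℕ) → κ) : Ideal (MvPowerSeries (Fin n) κ) :=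
  Ideal.span (Set.range (fun i => pd i (ser p c)))

/-- ISOLATED: `κ[[u]] ⧸ (∂a)` is finite-dimensional (finite Tjurina-type number).
[cite: BoubakriGreuelMarkwig2010, §2] -/
def Isol (c : (Fin n → ℕ) → κ) : Prop :=
  Module.Finite κ (MvPowerSeries (Fin n) κ ⧸ jac p c)

/-- MULTIPLICITY `p`: the cleaned state is non-zero and all its monomials have degree `≥ p`.
[cite: HauserPerlega2019, §1] -/
def MultP (c : (Fin n → ℕ) → κ) : Prop :=
  (∃ A, clean p c A ≠ 0) ∧ ∀ A, clean p c A ≠ 0 → p ≤ Finset.sum Finset.univ (fun j => A j)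

/-- CLEANED ORDER EXACTLY `p`: some cleaned monomial has degree `p`. [cite: HauserPerlega2019, §1] -/
def OrdP (c : (Fin n → ℕ) → κ) : Prop :=
  ∃ A, clean p c A ≠ 0 ∧ Finset.sum Finset.univ (fun j => A j) = p

/-- The TANGENT CONE datum: the degree-`p` part `a_p` of the cleaned state, as a polynomial.
[cite: Hironaka2003, §1] -/
def cone (c : (Fin n → ℕ) → κ) : MvPolynomial (Fin n) κ :=
  Finset.sum (Fintype.piFinset (fun _ : Fin n => Finset.range (p + 1))) (fun A => @ite (MvPolynomial (Fin n) κ) (Finset.sum Finset.univ (fun j => A j) = p) (Classical.dec _) (MvPolynomial.monomial (Finsupp.equivFunOnFinite.symm A) (clean p c A)) 0)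

/-- The CONE-INVARIANCE SPACE `L(a_p) = {w | a_p(X + w·S) = a_p(X) + a_p(w)·Sᵖ}` (a polynomial
identity in a fresh variable `S = X none`; field-size independent). [cite: Hironaka1970AdditiveGroups, Thm 2] -/
def Linv (c : (Fin n → ℕ) → κ) : Set (Fin n → κ) :=
  {w : Fin n → κ | MvPolynomial.aeval (fun j : Fin n => (MvPolynomial.X (some j) : MvPolynomial (Option (Fin n)) κ) + MvPolynomial.C (w j) * MvPolynomial.X none) (cone p c) = MvPolynomial.rename some (cone p c) + MvPolynomial.C (MvPolynomial.eval w (cone p c)) * (MvPolynomial.X none) ^ p}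

/-- `dL = dim span L(a_p)`. [cite: Hironaka1970AdditiveGroups, Thm 2] -/
def dL (c : (Fin n → ℕ) → κ) : ℕ :=
  Module.finrank κ (Submodule.span κ (Linv p c))

/-! ### Glue fact (proved): a non-zero vector of `L` makes `dL ≥ 1` -/

/-- If some non-zero `v` lies in the cone-invariance space then `1 ≤ dL`: the line `κ ∙ v` sits
inside `span L` and has `finrank 1`. [folklore] -/
theorem one_le_dL_of_mem {c : (Fin n → ℕ) → κ} {v : Fin n → κ} (hv : v ∈ Linv p c)
    (hv0 : v ≠ 0) : 1 ≤ dL p c := by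
  unfold dL
  calc 1 = Module.finrank κ (Submodule.span κ ({v} : Set (Fin n → κ))) :=
        (finrank_span_singleton hv0).symm
    _ ≤ Module.finrank κ (Submodule.span κ (Linv p c)) :=
        Submodule.finrank_mono (Submodule.span_mono (Set.singleton_subset_iff.mpr hv))

end Calculus

/-! ## The three stub STATEMENTS by name (`Sig.stub_<name>`; the composition `ConeExit_of` takes
exactly these as hypotheses, so the skeleton audit admits them as declared stubs) -/

/-- Statement of `stub_caseA`: multiplicity `p` at `c` and an isolated multiplicity-`p` successor
force cleaned order EXACTLY `p` (Case A: order `> p` exits). [cite: CossartJannsenSaito2020, Lemma 6.33] -/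
def Sig.stub_caseA : Prop :=
  ∀ p : ℕ, p.Prime → p ≠ 2 → ∀ n : ℕ, 3 ≤ n → ∀ (κ : Type) [Field κ] [CharP κ p] [PerfectField κ] (c : (Fin n → ℕ) → κ) (i : Fin n) (τ : Fin n → κ), MultP p c → Isol p (step p i τ c) → MultP p (step p i τ c) → OrdP p c

/-- Statement of `stub_nearDirection`: at cleaned order exactly `p`, a multiplicity-`p` successor
in chart `i` at translation `τ` forces the direction `e_i + Σ_{j≠i} τ_j e_j` of the new point into
the cone-invariance space `L(a_p)` (near points lie on `P(L)`). [cite: Hironaka1970AdditiveGroups, Thm 2] -/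
def Sig.stub_nearDirection : Prop :=
  ∀ p : ℕ, p.Prime → p ≠ 2 → ∀ n : ℕ, 3 ≤ n → ∀ (κ : Type) [Field κ] [CharP κ p] [PerfectField κ] (c : (Fin n → ℕ) → κ) (i : Fin n) (τ : Fin n → κ), MultP p c → OrdP p c → MultP p (step p i τ c) → Function.update τ i 1 ∈ Linv p c

/-- Statement of `stub_coneForcing`: at cleaned order exactly `p` (odd `p`, `n ≥ 3`), an ISOLATED
multiplicity-`p` successor forces `dL ≤ 1` (a wild cone with `dim L ≥ 2` has a critical direction
and the blow-up is singular along a curve through every near point). [cite: Jouanolou1979, Ch. 1] -/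
def Sig.stub_coneForcing : Prop :=
  ∀ p : ℕ, p.Prime → p ≠ 2 → ∀ n : ℕ, 3 ≤ n → ∀ (κ : Type) [Field κ] [CharP κ p] [PerfectField κ] (c : (Fin n → ℕ) → κ) (i : Fin n) (τ : Fin n → κ), MultP p c → OrdP p c → Isol p (step p i τ c) → MultP p (step p i τ c) → dL p c ≤ 1

/-! ## The stubs -/

/-- **STUB (Case A exit; true, size M).** Cleaned order `> p` admits no isolated multiplicity-`p`
successor when `n ≥ 3`: in the `uᵢ`-chart the successor is `uᵢ^{m-p}·a'`, and a multiplicity-`p`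
point of the exceptional hyperplane lies on the positive-dimensional `{a_m = 0} ∩ E ⊆ Sing` (or all
of `E` is singular when `m ≥ p + 2`), so `κ[[u]] ⧸ jac` is infinite-dimensional.
[cite: CossartJannsenSaito2020, Lemma 6.33] -/
theorem stub_caseA : ∀ p : ℕ, p.Prime → p ≠ 2 → ∀ n : ℕ, 3 ≤ n → ∀ (κ : Type) [Field κ] [CharP κ p] [PerfectField κ] (c : (Fin n → ℕ) → κ) (i : Fin n) (τ : Fin n → κ), MultP p c → Isol p (step p i τ c) → MultP p (step p i τ c) → OrdP p c := by
  sorry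

/-- **STUB (near points lie on `P(L)`; true, size M).** The `uᵢ`-free monomials of degree
`1 … p-1` of `step p i τ c` are the Hasse–Taylor coefficients of `a_p(v + u'')`, `v = update τ i 1`,
on `H = {u''ᵢ = 0}`; multiplicity `p` of the successor kills them, so `a_p(v + w) = a_p(v) + a_p(w)`
on `H`, and homogeneity plus `(Xᵢ + S)ᵖ = Xᵢᵖ + Sᵖ` give the defining identity of `Linv` at `v`.
[cite: Hironaka1970AdditiveGroups, Thm 2] -/
theorem stub_nearDirection : ∀ p : ℕ, p.Prime → p ≠ 2 → ∀ n : ℕ, 3 ≤ n → ∀ (κ : Type) [Field κ] [CharP κ p] [PerfectField κ] (c : (Fin n → ℕ) → κ) (i : Fin n) (τ : Fin n → κ), MultP p c → OrdP p c → MultP p (step p i τ c) → Function.update τ i 1 ∈ Linv p c := by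
  sorry

/-- **STUB (cone forcing; the load-bearing, NEW one, size L).** `p` odd, `n ≥ 3`, cleaned order
exactly `p`, successor isolated of multiplicity `p` ⇒ `dL ≤ 1`: if `d = dim L ≥ 2` the
gradient-invariance space `M ⊇ L` has `m ≥ 3`, the Chern lemma (`WildCones.ChernCriticalDirection`,
stmt-16885) gives a critical direction of the cone modulo `M`, and `Sing(X') ∩ E ⊇ P(N) ∩ {Θ_N = 0}
∩ {a_{p+1} = 0}` is positive-dimensional through every near point — the successor is not isolated.
False for `p = 2` (contact form), vacuous for `n = 3`. [cite: Jouanolou1979, Ch. 1] -/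
theorem stub_coneForcing : ∀ p : ℕ, p.Prime → p ≠ 2 → ∀ n : ℕ, 3 ≤ n → ∀ (κ : Type) [Field κ] [CharP κ p] [PerfectField κ] (c : (Fin n → ℕ) → κ) (i : Fin n) (τ : Fin n → κ), MultP p c → OrdP p c → Isol p (step p i τ c) → MultP p (step p i τ c) → dL p c ≤ 1 := by
  sorry

/-! ## The composition (kernel-checked; no `sorry` in its own term) -/

/-- **`ConeExit` from the three stub statements** — the assembly, PROVED. The route decl unfolds
to the factored calculus by `ζ`/`δ`-reduction (the `show`), Case A gives `OrdP`, the near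
direction `v = update τ i 1 ∈ L` with `v i = 1 ≠ 0` gives `1 ≤ dL`, cone forcing gives `dL ≤ 1`.
[folklore] -/
theorem ConeExit_of :
    Sig.stub_caseA → Sig.stub_nearDirection → Sig.stub_coneForcing → ConeExit := by
  intro hA hB hC p hp hp2 n hn κ _ _ _ c i τ
  show Isol p c → MultP p c → Isol p (step p i τ c) → MultP p (step p i τ c) → OrdP p c ∧ dL p c = 1
  intro _ hM hI' hM'
  have hO : OrdP p c := hA p hp hp2 n hn κ c i τ hM hI' hM'
  have hv : Function.update τ i 1 ∈ Linv p c := hB p hp hp2 n hn κ c i τ hM hO hM'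
  have hv0 : Function.update τ i (1 : κ) ≠ 0 := by
    intro h
    have h1 := congrFun h i
    simp at h1
  exact ⟨hO, le_antisymm (hC p hp hp2 n hn κ c i τ hM hO hI' hM') (one_le_dL_of_mem p hv hv0)⟩

/-- **The crux `ConeExit`, assembled from the three registered stubs** (the skeleton in its final
shape; the only `sorry`s in its closure are the three stubs, none of its own). -/
theorem ConeExit_proof : ConeExit :=
  ConeExit_of stub_caseA stub_nearDirection stub_coneForcing

end Summit.ResolutionOfSingularities.ResolutionOfSingularities.Cruxes.ConeExit.Lines.Birth

end
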